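import Summits.CriticalPhenomena.Ising3D.IsingStripL11Instances
import Summits.CriticalPhenomena.Ising3D.IsingStripL11Cover
import HarnessLib

/-!
# F-CP1 branch (1a-c) «COLUMN FACES ONLY», typed statement-first: the certified two-sided BRACKET on `Δε`
# at the Ising σ-column, modulo named certificate hypotheses
(cell `crit-ising-boot`, seat typing-1 gen 2; owner RULING K0P-FAIL, pub-ising3x LEAD g43 2026-08-28T20:06:49Z, to be
folded as PRE-REG v9 C17 — the K0′-FAIL branch made mechanical in advance: «(1a-c) COLUMN FACES ONLY := ONE column, the
column of record, completed to the window»; D-0160 statement-first: this file lands the SHAPE before any T1c certificate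
run is keyed, exactly as `IsingStripL11` did for (1a)/(1b). Nothing in this file is a certificate.)

HONEST FRAMING: lottery ticket; floor = tightest certified 3D Ising CFT bounds; floating SDPB islands, however precise,
are not certificates; nothing is called certified that is not kernel- or interval/exact-certified at the stated standard;
no exact-solution or exact-exponent claim. The object of this file is, in the owner's words, «a certified two-sided bracket
on `Δε` at the Ising σ-column, never called a strip, an island or a determination of the exponents»; wording guard W1:
never «first rigorous bootstrap result/bound in d = 3».

THE OBJECT (every literal already of record): the σ-cell `σcell = [33957/65536, 16979/32768]` (`ColumnFaceL11.σcell`,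
∋ 0.5181489) over `W₁₁`'s ε-range `[6/5, 8/5]`; TARGET shape
`IsingEnclosure (σcell ×ˢ Icc (6/5) (8/5)) (σcell ×ˢ Icc (2855/2048) (185/128))`, i.e. «at Λ = 11 under A1–A4, `Δσ ∈ σcell`
and `Δε ∈ [6/5, 8/5]` ⇒ `2855/2048 ≤ Δε ≤ 185/128`», where the LOWER face `2855/2048` over `[81/64, 8/5]` is INHERITED from
`ColumnFaceL11.isingColumnFace_L11_Icc` [kernel mod the 42 S3 hypotheses `ColumnCertificatesL11`, p625355] and not re-run.

WHAT IS TYPED: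
* `UpperFaceCertificatesL11 eTop cover` — the (U) leg as HYPOTHESES, PARAMETRIC in the lowest certified tile edge `eTop : ℚ`
  reached by the top-down chain and in the finite tile list `cover : List BoxQ` (column tiles `StripL11.colTile lo hi` of
  record class σ-extent 2⁻¹⁶, or any boxes): fields `covers : σcell × [eTop, 8/5] ⊆ ⋃ cover` (exact rational arithmetic once
  the list is hash-rowed; discharger `upperFaceCertificatesL11_of_cert`, one `decide +kernel`) and `excluded` (one Λ = 11
  `ising3d-cert-v1` deriv certificate at standard S3 per tile, A-mix = `SatisfiesBootstrapAxioms` A1–A4 VERBATIM — no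
  `λσσε = λσεσ`, no θ-scan, no stress-tensor / twist-gap input). The top-down keying step is `UpperFaceCertificatesL11.extend`
  (each new PASS tile `colTile e' e` lowers `eTop` from `e` to `e'`: the owner's «monotone value»).
* `LowerSliverCertificatesL11 cover` — the (L) leg: `σcell × [6/5, 81/64] ⊆ ⋃ cover`, each tile excluded.
* `isingColumnBracket_L11 : ColumnCertificatesL11 → UpperFaceCertificatesL11 eTop cover →
  IsingEnclosure (σcell ×ˢ Icc (81/64) (8/5)) (σcell ×ˢ Icc (2855/2048) eTop)` — «the theorem of record at ANY date»; the
  strict form `…_strict` (`2855/2048 < Δε < eTop`) is what is actually proved; `isingColumnBracket_L11_window` adds (L) and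
  concludes the TARGET literally (`eTop = 185/128`), `isingColumnBracket_L11_fullWindow` the same for any `eTop`.
* TODAY'S INSTANCE, no new certificate: the segment `[3/2, 8/5]` of the upper face is ALREADY EXCLUDED IN THE KERNEL — the
  tree's single-correlator point-kernel column `PointKernelK34v2.no_cft_in_K34v2_strip` (`0.5175 ≤ Δσ ≤ 0.5185`, `Δε ≥ 3/2`;
  pub-ising3d, standard S1 = kernel; cf. `StripL11.kernelTile_excluded`, referee-1 g2 F-g2-3) contains the σ-cell, so
  `upperFaceCertificatesL11_today : UpperFaceCertificatesL11 (3/2) [colTile (3/2) (8/5)]` holds outright and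
  `isingColumnBracket_L11_today : ColumnCertificatesL11 → IsingEnclosure (σcell ×ˢ Icc (81/64) (8/5)) (σcell ×ˢ Icc (2855/2048) (3/2))`
  [kernel mod the 42 S3 hypotheses of record]: «`Δσ ∈ σcell`, `81/64 ≤ Δε ≤ 8/5` ⇒ `2855/2048 ≤ Δε ≤ 3/2`» is the bracket of
  record on day 0 of (1a-c), and the (U) chain's first S3 tile can be keyed at `3/2`, not `8/5` (typing-side FACT for the
  owner's T1c estimate: (U) span `3/2 − 185/128 = 7/128 ≈ 0.0547`, not `0.1547`). The unbounded form
  `isingColumnBracket_L11_today_Ici` drops the window's upper edge (`Δε ≥ 81/64` suffices).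
* HYPOTHESIS-LEVEL SHORTCUT, typed but NOT claimed at F-CP1's standard: the tree's `IsingEnclosureGlobal.GlobalCertificates`
  field `upper_05175_05185 : SigmaBoxExcluded ([0.5175, 0.5185] × [1.45, ∞))` (pub-ising3d K34 point certificate
  `pointcert_K34_dsig5175-5185_deps1.45-inf_v1.json` sha256 `9657004c0a87bc57…`, checked by two independent programs — verifier A
  exact-rational / 256-bit interval, verifier B Taylor-model; «not kernel-grade as a table») would give `eTop = 29/20` through
  `upperFaceCertificatesL11_of_sigmaStrip` / `isingColumnBracket_L11_of_sigmaStrip`; by owner RULING (1a-c)-HEAD (2), pub-ising3x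
  LEAD g43 2026-08-28T20:28:38Z = PRE-REG v10 C18: «NOT KERNEL IS NOT A FACT: `GlobalCertificates.upper_05175_05185` … is NOT
  ADMISSIBLE as a discharged hypothesis of any F-CP1 theorem of record» — hypothesis not dischargeable at F-CP1's standard;
  implication recorded only; the reached edge `eTop` of record moves ONLY by kernel facts (S3 tiles of record or other
  landed kernel theorems).
VACUITY GUARDS: the empty tile list is never an upper-face / lower-sliver certificate (`not_upperFaceCertificatesL11_nil`,
`not_lowerSliverCertificatesL11_nil`); the target bracket is non-empty (∋ the KPSDV float centre **[print]**, arithmetic only),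
proper (the window points `(33957/65536, 8/5)` and `(33957/65536, 6/5)` lie outside it) and sits inside `B₁₁` of (1a)
(`bracket_subset_B₁₁`: on the column the completed (1a-c) claims MORE than (1a) would, because the lower face of record
`2855/2048 > 89/64` is inherited); A1–A4 are satisfiable and every known satisfying family of the tree misses the column
(`StripL11.axioms_satisfiable`, `StripL11.gff_witnesses_not_mem_W₁₁`; the column window lies in `W₁₁`: `window_subset_W₁₁`).
WHAT THIS FILE SHOWS BY ITSELF about the 3D Ising CFT: nothing beyond «the cover step is right» and the re-packaging of two
landed kernel theorems (the column's lower face modulo S3, the point-kernel strip at `3/2`). [folklore]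
-/

namespace Summit.CriticalPhenomena.Ising3D

open Set Literature.MathematicalPhysics.QuantumFieldTheory.ConformalBootstrap3D

namespace ColumnBracketL11

open ColumnFaceL11 StripL11

/-! ### The two hypothesis structures of (1a-c) -/

/-- **(U) the UPPER FACE certificates as HYPOTHESES, parametric in the reached edge and the tiling.** `eTop : ℚ` is the
lowest certified tile edge reached by the top-down chain (hash-rowed per tile before its run; `185/128 = ∂B₁₁` at completion),
`cover` the finite list of tiles (column tiles `colTile lo hi` of record class, keyed top-down; any rational boxes are
admitted). Fields: the cover obligation of `σcell × [eTop, 8/5]` (exact rational arithmetic once the list is fixed) and one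
`BoxExcluded` per tile = one Λ = 11 `ising3d-cert-v1` deriv certificate at standard S3 (two implementations, 0 disagreements,
controls of record rejected, readers per U1-F/U1-G) or S2/S1 (kernel), under A-mix = `SatisfiesBootstrapAxioms` verbatim.
A bookkeeping definition; nothing is asserted. [folklore] -/
@[folklore] structure UpperFaceCertificatesL11 (eTop : ℚ) (cover : List BoxQ) : Prop where
  /-- Cover obligation: the tiles cover the column segment `σcell × [eTop, 8/5]`. -/
  covers : σcell ×ˢ Icc (eTop : ℝ) (8 / 5) ⊆ ⋃ Q ∈ cover, Q.toSet
  /-- One certificate per tile. -/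
  excluded : ∀ Q ∈ cover, BoxExcluded Q.toSet

/-- **(L) the LOWER SLIVER certificates as HYPOTHESES** («only after (U) reaches `185/128` or stops: the LOWER SLIVER
`σcell × [6/5, 81/64]` bottom-up, which extends the window from `[81/64, 8/5]` to `W₁₁`'s `[6/5, 8/5]` and changes no bracket
endpoint»): the tiles cover `σcell × [6/5, 81/64]`, each excluded (one Λ = 11 certificate per tile, S3). Nothing is asserted.
[folklore] -/
@[folklore] structure LowerSliverCertificatesL11 (cover : List BoxQ) : Prop where
  /-- Cover obligation: the tiles cover `σcell × [6/5, 81/64]`. -/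
  covers : σcell ×ˢ Icc (6 / 5 : ℝ) (81 / 64) ⊆ ⋃ Q ∈ cover, Q.toSet
  /-- One certificate per tile. -/
  excluded : ∀ Q ∈ cover, BoxExcluded Q.toSet

/-- No datum of the column lies in a covered-and-excluded segment. Elementary. [folklore] -/
theorem not_mem_of_cover {S : Set (ℝ × ℝ)} {cover : List BoxQ} (hcov : S ⊆ ⋃ Q ∈ cover, Q.toSet)
    (hex : ∀ Q ∈ cover, BoxExcluded Q.toSet) (D : SigmaEpsilonData) (hD : D.SatisfiesBootstrapAxioms) :
    (D.Δσ, D.Δε) ∉ S := by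
  intro hS
  have h := hcov hS
  rw [mem_iUnion₂] at h
  obtain ⟨Q, hQ, hp⟩ := h
  exact hex Q hQ D hD hp

/-- The (U) leg read as an inequality: under `UpperFaceCertificatesL11 eTop cover`, a datum with `Δσ ∈ σcell` and
`Δε ≤ 8/5` has `Δε < eTop`. Elementary. [folklore] -/
theorem UpperFaceCertificatesL11.epsDim_lt {eTop : ℚ} {cover : List BoxQ} (h : UpperFaceCertificatesL11 eTop cover)
    (D : SigmaEpsilonData) (hD : D.SatisfiesBootstrapAxioms) (hσ : D.Δσ ∈ σcell) (hhi : D.Δε ≤ 8 / 5) :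
    D.Δε < (eTop : ℝ) := by
  by_contra hle
  exact not_mem_of_cover h.covers h.excluded D hD (mk_mem_prod hσ ⟨not_lt.mp hle, hhi⟩)

/-- The (L) leg read as an inequality: under `LowerSliverCertificatesL11 cover`, a datum with `Δσ ∈ σcell` and `6/5 ≤ Δε`
has `81/64 < Δε`. Elementary. [folklore] -/
theorem LowerSliverCertificatesL11.lt_epsDim {cover : List BoxQ} (h : LowerSliverCertificatesL11 cover)
    (D : SigmaEpsilonData) (hD : D.SatisfiesBootstrapAxioms) (hσ : D.Δσ ∈ σcell) (hlo : (6 / 5 : ℝ) ≤ D.Δε) :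
    (81 / 64 : ℝ) < D.Δε := by
  by_contra hle
  exact not_mem_of_cover h.covers h.excluded D hD (mk_mem_prod hσ ⟨hlo, not_lt.mp hle⟩)

/-! ### The assembled bracket theorems (CONDITIONAL on the hypothesis structures) -/

/-- **The theorem of record at ANY date of (1a-c), strict form**: under the 42 column certificates of record and the upper-face
certificates down to `eTop`, every σ–ε datum satisfying A1–A4 with `Δσ ∈ σcell`, `81/64 ≤ Δε ≤ 8/5` has
`2855/2048 < Δε < eTop`. Certified exclusion statement at stated derivative order (Λ = 11) and assumptions, modulo its named
hypotheses; not a determination of the 3D Ising critical exponents beyond that. [folklore] -/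
theorem isingColumnBracket_L11_strict (hcol : ColumnCertificatesL11) {eTop : ℚ} {cover : List BoxQ}
    (hU : UpperFaceCertificatesL11 eTop cover) :
    IsingEnclosure (σcell ×ˢ Icc (81 / 64 : ℝ) (8 / 5)) {p | p.1 ∈ σcell ∧ (2855 / 2048 : ℝ) < p.2 ∧ p.2 < (eTop : ℝ)} := by
  intro D hD hW
  obtain ⟨hσ, hlo, hhi⟩ := hW
  exact ⟨hσ, epsDim_gt_face hcol D hD hσ hlo, hU.epsDim_lt D hD hσ hhi⟩

/-- **The theorem of record at ANY date of (1a-c), in the owner's closed-bracket shape**: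
`IsingEnclosure (σcell ×ˢ Icc (81/64) (8/5)) (σcell ×ˢ Icc (2855/2048) eTop)` with `eTop` = the lowest certified tile edge
reached («monotone value: every PASS tightens a certified upper bound on `Δε`»). CONDITIONAL on `hcol` (42 S3 hypotheses) and
`hU`. [folklore] -/
theorem isingColumnBracket_L11 (hcol : ColumnCertificatesL11) {eTop : ℚ} {cover : List BoxQ}
    (hU : UpperFaceCertificatesL11 eTop cover) :
    IsingEnclosure (σcell ×ˢ Icc (81 / 64 : ℝ) (8 / 5)) (σcell ×ˢ Icc (2855 / 2048 : ℝ) (eTop : ℝ)) := by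
  intro D hD hW
  obtain ⟨hσ, h1, h2⟩ := isingColumnBracket_L11_strict hcol hU D hD hW
  exact mk_mem_prod hσ ⟨le_of_lt h1, le_of_lt h2⟩

/-- **The bracket on `W₁₁`'s full ε-range for any reached edge**: with the lower sliver certified as well, the window
extends from `[81/64, 8/5]` to `[6/5, 8/5]` and no bracket endpoint changes. CONDITIONAL on `hcol`, `hU`, `hL`. [folklore] -/
theorem isingColumnBracket_L11_fullWindow (hcol : ColumnCertificatesL11) {eTop : ℚ} {coverU coverL : List BoxQ}
    (hU : UpperFaceCertificatesL11 eTop coverU) (hL : LowerSliverCertificatesL11 coverL) :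
    IsingEnclosure (σcell ×ˢ Icc (6 / 5 : ℝ) (8 / 5)) (σcell ×ˢ Icc (2855 / 2048 : ℝ) (eTop : ℝ)) := by
  intro D hD hW
  obtain ⟨hσ, hlo, hhi⟩ := hW
  exact isingColumnBracket_L11 hcol hU D hD (mk_mem_prod hσ ⟨le_of_lt (hL.lt_epsDim D hD hσ hlo), hhi⟩)

/-- **The TARGET of (1a-c), literally** (owner 2026-08-28T20:06:49Z): «at Λ = 11 under A1–A4, `Δσ ∈ σcell` and `Δε ∈ [6/5, 8/5]`
⇒ `2855/2048 ≤ Δε ≤ 185/128`» — `IsingEnclosure (σcell ×ˢ Icc (6/5) (8/5)) (σcell ×ˢ Icc (2855/2048) (185/128))`, assembled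
modulo the 42 column certificates of record, the upper-face certificates down to `185/128 = ∂B₁₁` and the lower-sliver
certificates. A certified two-sided bracket on `Δε` at the Ising σ-column at stated Λ and assumptions; never a strip, an
island or a determination of the exponents. [folklore] -/
theorem isingColumnBracket_L11_window (hcol : ColumnCertificatesL11) {coverU coverL : List BoxQ}
    (hU : UpperFaceCertificatesL11 (185 / 128) coverU) (hL : LowerSliverCertificatesL11 coverL) :
    IsingEnclosure (σcell ×ˢ Icc (6 / 5 : ℝ) (8 / 5)) (σcell ×ˢ Icc (2855 / 2048 : ℝ) (185 / 128)) := by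
  have h := isingColumnBracket_L11_fullWindow hcol hU hL
  have e : ((185 / 128 : ℚ) : ℝ) = 185 / 128 := by norm_num
  rwa [e] at h

/-! ### Mechanics of the top-down chain and the dischargers of the cover obligations -/

/-- The rational column tile as a product set: `(colTile lo hi).toSet = σcell ×ˢ Icc lo hi`. [folklore] -/
theorem colTile_toSet_prod (lo hi : ℚ) : (colTile lo hi).toSet = σcell ×ˢ Icc (lo : ℝ) (hi : ℝ) :=
  colTile_toSet lo hi

/-- Membership in a column tile from its three inequalities, the ε-ends given as real numerals equal to the casts
(`rfl` for a variable end, `by norm_num` for a literal one). [folklore] -/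
theorem mem_colTile {lo hi : ℚ} {lo' hi' : ℝ} (hlo : (lo : ℝ) = lo') (hhi : (hi : ℝ) = hi') {p : ℝ × ℝ}
    (hσ : p.1 ∈ σcell) (h1 : lo' ≤ p.2) (h2 : p.2 ≤ hi') : p ∈ (colTile lo hi).toSet := by
  rw [colTile_toSet_prod, hlo, hhi]
  exact ⟨hσ, h1, h2⟩

/-- **Top-down keying step** («the theorem of record at ANY date … `eTop` = the lowest certified tile edge reached»): a new
excluded column tile `colTile e' e` hanging from the reached edge `e` lowers the edge to `e'`. [folklore] -/
theorem UpperFaceCertificatesL11.extend {e e' : ℚ} {cover : List BoxQ} (h : UpperFaceCertificatesL11 e cover)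
    (hQ : BoxExcluded (colTile e' e).toSet) : UpperFaceCertificatesL11 e' (colTile e' e :: cover) := by
  refine ⟨fun p hp => ?_, fun Q hQm => ?_⟩
  · obtain ⟨hσ, h1, h2⟩ := hp
    rw [mem_iUnion₂]
    by_cases hpe : p.2 ≤ (e : ℝ)
    · exact ⟨colTile e' e, List.mem_cons_self, (colTile_toSet_prod e' e).symm ▸ mk_mem_prod hσ ⟨h1, hpe⟩⟩
    · have hc := h.covers (mk_mem_prod hσ ⟨le_of_lt (not_le.mp hpe), h2⟩)
      rw [mem_iUnion₂] at hc
      obtain ⟨Q, hQm, hpQ⟩ := hc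
      exact ⟨Q, List.mem_cons_of_mem _ hQm, hpQ⟩
  · rcases List.mem_cons.mp hQm with rfl | hQ'
    · exact hQ
    · exact h.excluded Q hQ'

/-- The start of the chain: above the window there is nothing to certify (`eTop = 8/5`, one degenerate tile — or see
`upperFaceCertificatesL11_today` for the kernel's free head start at `3/2`). [folklore] -/
theorem upperFaceCertificatesL11_top (Q : BoxQ) (hQ : BoxExcluded Q.toSet) (hc : (colTile (8 / 5) (8 / 5)).toSet ⊆ Q.toSet) :
    UpperFaceCertificatesL11 (8 / 5) [Q] := by
  refine ⟨fun p hp => ?_, fun Q' hQ' => ?_⟩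
  · rw [mem_iUnion₂]
    exact ⟨Q, List.mem_cons_self, hc (mem_colTile rfl (by norm_num) hp.1 hp.2.1 hp.2.2)⟩
  · rcases List.mem_cons.mp hQ' with rfl | h
    · exact hQ
    · simp at h

/-- **`UpperFaceCertificatesL11` by certificate**: a `CoverCert` run on the segment box `colTile eTop (8/5)` with no
un-excluded part (`ub = []`) discharges `covers` by ONE `decide +kernel` once the tile list is hash-rowed. [folklore] -/
theorem upperFaceCertificatesL11_of_cert {eTop : ℚ} {cover : List BoxQ} (c : CoverCert)
    (h : (c.run [] none (colTile eTop (8 / 5)) cover).isSome = true) (hex : ∀ Q ∈ cover, BoxExcluded Q.toSet) :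
    UpperFaceCertificatesL11 eTop cover := by
  refine ⟨fun p hp => ?_, hex⟩
  have h' := CoverCert.diff_subset_of_run [] (colTile eTop (8 / 5)) cover c h
  exact h' ⟨mem_colTile rfl (by norm_num) hp.1 hp.2.1 hp.2.2, by simp⟩

/-- **`LowerSliverCertificatesL11` by certificate**: a `CoverCert` run on `colTile (6/5) (81/64)` with `ub = []`. [folklore] -/
theorem lowerSliverCertificatesL11_of_cert {cover : List BoxQ} (c : CoverCert)
    (h : (c.run [] none (colTile (6 / 5) (81 / 64)) cover).isSome = true) (hex : ∀ Q ∈ cover, BoxExcluded Q.toSet) :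
    LowerSliverCertificatesL11 cover := by
  refine ⟨fun p hp => ?_, hex⟩
  have h' := CoverCert.diff_subset_of_run [] (colTile (6 / 5) (81 / 64)) cover c h
  exact h' ⟨mem_colTile (by norm_num) (by norm_num) hp.1 hp.2.1 hp.2.2, by simp⟩

/-! ### Today's instance: the head `[3/2, 8/5]` of the upper face is a kernel theorem (point-kernel column, S1) -/

/-- **The column above `Δε = 3/2` is EXCLUDED, unconditionally [kernel]**: the σ-cell lies inside the tree's landed
single-correlator point-kernel column `0.5175 ≤ Δσ ≤ 0.5185` of `PointKernelK34v2.no_cft_in_K34v2_strip` (`Δε ≥ 3/2`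
excluded; pub-ising3d, standard S1). Unbounded above. [folklore] -/
theorem colStrip_top_excluded : BoxExcluded (σcell ×ˢ Ici (3 / 2 : ℝ)) := by
  intro D hD hmem
  obtain ⟨⟨h1, h2⟩, h3⟩ := hmem
  simp only [mem_Ici] at h3
  exact PointKernelK34v2.no_cft_in_K34v2_strip D hD (by norm_num at h1 ⊢; linarith)
    (by norm_num at h2 ⊢; linarith) (by norm_num at h3 ⊢; linarith)

/-- Hence the top column tile `colTile (3/2) (8/5)` is excluded [kernel] (also: it lies inside `StripL11.kernelTile`).
[folklore] -/
theorem colTile_top_excluded : BoxExcluded (colTile (3 / 2) (8 / 5)).toSet := by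
  refine colStrip_top_excluded.mono ?_
  rw [colTile_toSet_prod]
  push_cast
  exact prod_mono Subset.rfl Icc_subset_Ici_self

/-- **TODAY's (U) instance, no new certificate**: `UpperFaceCertificatesL11 (3/2) [colTile (3/2) (8/5)]` [kernel]. The (U)
chain's first S3 tile can therefore be keyed at `3/2` (span to `185/128`: `7/128`). [folklore] -/
theorem upperFaceCertificatesL11_today : UpperFaceCertificatesL11 (3 / 2) [colTile (3 / 2) (8 / 5)] := by
  refine ⟨fun p hp => ?_, fun Q hQ => ?_⟩
  · rw [mem_iUnion₂]
    exact ⟨colTile (3 / 2) (8 / 5), List.mem_cons_self, mem_colTile rfl (by norm_num) hp.1 hp.2.1 hp.2.2⟩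
  · rcases List.mem_cons.mp hQ with rfl | h
    · exact colTile_top_excluded
    · simp at h

/-- **THE BRACKET OF RECORD ON DAY 0 OF (1a-c)** [kernel modulo the 42 S3 hypotheses of `ColumnCertificatesL11`]: every σ–ε
datum satisfying A1–A4 with `Δσ ∈ σcell` and `81/64 ≤ Δε ≤ 8/5` has `2855/2048 ≤ Δε ≤ 3/2` (strictly inside, in fact). Lower
face = the column campaign of record (Λ = 11, S3); upper face = the point-kernel column (S1). Not a strip, not an island, not
a determination of the exponents. [folklore] -/
theorem isingColumnBracket_L11_today (hcol : ColumnCertificatesL11) :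
    IsingEnclosure (σcell ×ˢ Icc (81 / 64 : ℝ) (8 / 5)) (σcell ×ˢ Icc (2855 / 2048 : ℝ) (3 / 2)) := by
  have h := isingColumnBracket_L11 hcol upperFaceCertificatesL11_today
  have e : ((3 / 2 : ℚ) : ℝ) = 3 / 2 := by norm_num
  rwa [e] at h

/-- The same with the window's upper edge dropped (the point-kernel column is unbounded above): `Δσ ∈ σcell`, `81/64 ≤ Δε`
⇒ `2855/2048 < Δε < 3/2` [kernel mod 42 S3]. [folklore] -/
theorem isingColumnBracket_L11_today_Ici (hcol : ColumnCertificatesL11) :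
    IsingEnclosure (σcell ×ˢ Ici (81 / 64 : ℝ)) {p | p.1 ∈ σcell ∧ (2855 / 2048 : ℝ) < p.2 ∧ p.2 < 3 / 2} := by
  intro D hD hW
  obtain ⟨hσ, hlo⟩ := hW
  simp only [mem_Ici] at hlo
  have hup : D.Δε < 3 / 2 := by
    by_contra hle
    exact colStrip_top_excluded D hD (mk_mem_prod hσ (mem_Ici.mpr (not_lt.mp hle)))
  exact ⟨hσ, epsDim_gt_face hcol D hD hσ hlo, hup⟩

/-! ### Hypothesis-level shortcut — TYPED IMPLICATION ONLY: owner RULING (1a-c)-HEAD (2), pub-ising3x LEAD g43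
2026-08-28T20:28:38Z = PRE-REG v10 C18: «NOT KERNEL IS NOT A FACT: `GlobalCertificates.upper_05175_05185` … is NOT ADMISSIBLE as
a discharged hypothesis of any F-CP1 theorem of record» — hypothesis not dischargeable at F-CP1's standard; implication recorded
only -/

/-- A σ-excluded (single-correlator) strip `[0.5175, 0.5185] × [e, ∞)` containing the column gives the (U) structure down to
`e` with one tile. The tree's `IsingEnclosureGlobal.GlobalCertificates.upper_05175_05185` is such a hypothesis with
`e = 1.45 = 29/20` (pub-ising3d K34 point certificate, two independent programs, NOT kernel, NOT F-CP1's S3 pipeline);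
by owner RULING (1a-c)-HEAD (2), pub-ising3x LEAD g43 2026-08-28T20:28:38Z = PRE-REG v10 C18: «NOT KERNEL IS NOT A FACT:
`GlobalCertificates.upper_05175_05185` … is NOT ADMISSIBLE as a discharged hypothesis of any F-CP1 theorem of record» —
hypothesis not dischargeable at F-CP1's standard; implication recorded only. [folklore] -/
theorem upperFaceCertificatesL11_of_sigmaStrip {e : ℚ}
    (h : SigmaBoxExcluded (Icc (0.5175 : ℝ) 0.5185 ×ˢ Ici (e : ℝ))) :
    UpperFaceCertificatesL11 e [colTile e (8 / 5)] := by
  have hQ : BoxExcluded (colTile e (8 / 5)).toSet := by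
    refine h.boxExcluded.mono ?_
    rw [colTile_toSet_prod]
    rintro ⟨σ, ε⟩ ⟨⟨h1, h2⟩, h3, -⟩
    exact ⟨⟨by norm_num at h1 ⊢; linarith, by norm_num at h2 ⊢; linarith⟩, mem_Ici.mpr h3⟩
  refine ⟨fun p hp => ?_, fun Q hQm => ?_⟩
  · rw [mem_iUnion₂]
    exact ⟨colTile e (8 / 5), List.mem_cons_self, mem_colTile rfl (by norm_num) hp.1 hp.2.1 hp.2.2⟩
  · rcases List.mem_cons.mp hQm with rfl | h'
    · exact hQ
    · simp at h'

/-- The bracket that shortcut would give: `2855/2048 ≤ Δε ≤ 29/20` on the column window, CONDITIONAL on the 42 S3 hypotheses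
AND on the σ-excluded strip at `1.45` — owner RULING (1a-c)-HEAD (2), pub-ising3x LEAD g43 2026-08-28T20:28:38Z = PRE-REG v10
C18: «NOT KERNEL IS NOT A FACT: `GlobalCertificates.upper_05175_05185` … is NOT ADMISSIBLE as a discharged hypothesis of any
F-CP1 theorem of record» — hypothesis not dischargeable at F-CP1's standard; implication recorded only. [folklore] -/
theorem isingColumnBracket_L11_of_sigmaStrip (hcol : ColumnCertificatesL11)
    (h : SigmaBoxExcluded (Icc (0.5175 : ℝ) 0.5185 ×ˢ Ici (1.45 : ℝ))) :
    IsingEnclosure (σcell ×ˢ Icc (81 / 64 : ℝ) (8 / 5)) (σcell ×ˢ Icc (2855 / 2048 : ℝ) (29 / 20)) := by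
  have e1 : ((29 / 20 : ℚ) : ℝ) = 1.45 := by norm_num
  have hU := upperFaceCertificatesL11_of_sigmaStrip (e := 29 / 20) (by rwa [e1])
  have hB := isingColumnBracket_L11 hcol hU
  have e2 : ((29 / 20 : ℚ) : ℝ) = 29 / 20 := by norm_num
  rwa [e2] at hB

/-! ### Vacuity guards and consistency -/

/-- The column window lies in the strip window `W₁₁` of (1a) (so `StripL11.axioms_satisfiable` /
`StripL11.gff_witnesses_not_mem_W₁₁` apply: A1–A4 are satisfiable and the tree's satisfying families miss the column).
[folklore] -/
theorem window_subset_W₁₁ : σcell ×ˢ Icc (6 / 5 : ℝ) (8 / 5) ⊆ W₁₁ := by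
  rintro ⟨σ, ε⟩ ⟨⟨h1, h2⟩, h3, h4⟩
  norm_num at h1 h2
  exact ⟨⟨by linarith, by linarith⟩, h3, h4⟩

/-- The empty tile list is NOT an upper-face certificate for any edge inside the window. [folklore] -/
theorem not_upperFaceCertificatesL11_nil {eTop : ℚ} (he : eTop ≤ 8 / 5) : ¬ UpperFaceCertificatesL11 eTop [] := by
  intro h
  have hc : ((33957 / 65536 : ℝ), (8 / 5 : ℝ)) ∈ σcell ×ˢ Icc (eTop : ℝ) (8 / 5) := by
    refine mk_mem_prod ⟨le_rfl, by norm_num [σcell]⟩ ⟨?_, le_rfl⟩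
    have : ((eTop : ℚ) : ℝ) ≤ ((8 / 5 : ℚ) : ℝ) := by exact_mod_cast he
    push_cast at this
    exact this
  have := h.covers hc
  simp at this

/-- The empty tile list is NOT a lower-sliver certificate. [folklore] -/
theorem not_lowerSliverCertificatesL11_nil : ¬ LowerSliverCertificatesL11 [] := by
  intro h
  have hc : ((33957 / 65536 : ℝ), (6 / 5 : ℝ)) ∈ σcell ×ˢ Icc (6 / 5 : ℝ) (81 / 64) :=
    mk_mem_prod ⟨le_rfl, by norm_num [σcell]⟩ ⟨le_rfl, by norm_num⟩
  have := h.covers hc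
  simp at this

/-- The target bracket is non-empty: it contains the KPSDV 2016 float centre `(0.5181489, 1.412625)` **[print]** (arithmetic
only; no float number is a certificate). [folklore] -/
theorem kpsdv_centre_mem_bracket :
    ((0.5181489 : ℝ), (1.412625 : ℝ)) ∈ σcell ×ˢ Icc (2855 / 2048 : ℝ) (185 / 128) := by
  simp only [σcell, mem_prod, mem_Icc]
  norm_num

/-- … and proper: the window's top and bottom points on the column are outside it (the bracket says something on both
sides). [folklore] -/
theorem window_ends_not_mem_bracket :
    ((33957 / 65536 : ℝ), (8 / 5 : ℝ)) ∉ σcell ×ˢ Icc (2855 / 2048 : ℝ) (185 / 128) ∧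
      ((33957 / 65536 : ℝ), (6 / 5 : ℝ)) ∉ σcell ×ˢ Icc (2855 / 2048 : ℝ) (185 / 128) := by
  constructor
  · rintro ⟨-, -, h2⟩
    norm_num at h2
  · rintro ⟨-, h1, -⟩
    norm_num at h1

/-- Consistency with (1a): the completed (1a-c) bracket lies INSIDE `B₁₁ = [263/512, 67/128] × [89/64, 185/128]` — on the
σ-column it claims more than the strip would (`2855/2048 > 89/64`: the lower face of record is inherited). [folklore] -/
theorem bracket_subset_B₁₁ : σcell ×ˢ Icc (2855 / 2048 : ℝ) (185 / 128) ⊆ B₁₁ := by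
  rintro ⟨σ, ε⟩ ⟨⟨h1, h2⟩, h3, h4⟩
  norm_num at h1 h2
  exact ⟨⟨by linarith, by linarith⟩, by linarith, h4⟩

/-- Today's bracket `σcell × [2855/2048, 3/2]` is NOT inside `B₁₁` (its top `3/2 > 185/128`): the day-0 statement is honest
about being weaker than the target. [folklore] -/
theorem todayBracket_not_subset_B₁₁ : ¬ σcell ×ˢ Icc (2855 / 2048 : ℝ) (3 / 2) ⊆ B₁₁ := by
  intro h
  have hm : ((33957 / 65536 : ℝ), (3 / 2 : ℝ)) ∈ σcell ×ˢ Icc (2855 / 2048 : ℝ) (3 / 2) :=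
    mk_mem_prod ⟨le_rfl, by norm_num [σcell]⟩ ⟨by norm_num, le_rfl⟩
  obtain ⟨-, -, h4⟩ := h hm
  norm_num at h4

/-- Smoke test of the (U) discharger shape (`decide +kernel`): two column tiles `[3/2, 31/20]`, `[31/20, 8/5]` listed top-down
cover the segment above `3/2` (certificate `splitε (31/20) tile tile`). A shape test, not tiles of record. [folklore] -/
theorem upperFace_cert_smoke :
    ((CoverCert.splitε (31 / 20) .tile .tile).run [] none (colTile (3 / 2) (8 / 5))
      [colTile (3 / 2) (31 / 20), colTile (31 / 20) (8 / 5)]).isSome = true := by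
  decide +kernel

end ColumnBracketL11

end Summit.CriticalPhenomena.Ising3D
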